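import Summits.ValiantsHypothesis.ValiantsHypothesis.Theorems.SuccinctLiftSmlAnyFieldBDS
import Summits.ValiantsHypothesis.ValiantsHypothesis.Theorems.SuccinctLiftSmlAnyFieldDet

/-!
# SuccinctLift — determinant and permanent over ANY field at product depth `σ·log₂log₂log₂ n`, every `σ ≤ 18/25`

Support file for wall D of `route-ValiantsHypothesis-SuccinctLift` (stmt-ValiantsHypothesis-23721,
census cell W34 «2-non-unit cut»).  `SuccinctLiftSmlAnyFieldDet` decided the dial
`DetEasyOver K (⌊σ L₃⌋ + K₀)` / `PerEasyOver K (…)` negatively for every field `K` and every `σ < 1/2`,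
with the LST engine.  Here the tower bookkeeping is made ENGINE-AGNOSTIC
(`not_detEasyOver_of_immHard`, `not_perEasyOver_of_immHard`: any eventual `IMM_{m,⌊√log₂ m⌋}`
hardness statement at slope `p/q` over `K` gives the determinant / permanent dial at slope `p/q`
over `K`), and fed with the Forbes × Bhargav–Dutta–Saxena engine
`SuccinctLiftSmlAnyFieldBDS.immHard_anyField_bds` (every slope `≤ 18/25`, every field):
* `not_detEasyOver_anyField_of_le_18_25`: for EVERY field `K`, `25 p ≤ 18 q`, every `K₀`,
  `¬ DetEasyOver K (fun n => p * ⌊log₂⌊log₂⌊log₂ n⌋⌋⌋ / q + K₀)`;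
* `not_perEasyOver_anyField_of_le_18_25`: the same for the permanent (char `2`: `per = det`;
  char `≠ 2`: `VNP`-completeness of `per` over `K`);
* the W34 leaf over `𝔽̄₂` and `D_int(r, ·)` for every prime `r` at every slope `≤ 18/25`
  (`not_detEasyOver_algClosure_two_of_le_18_25`, `nonUnitHardAt_of_le_18_25`).
Reading for the census: the slope axis of the `𝔽̄₂` leaf of W34 is DECIDED on `[0, 18/25]` — the same
window the tree holds over `ℂ` for general circuits (`DepthWindow.immHardAt_of_le_18_25`,
`DefinabilityGapK1DepthLadder.perHard_io_log3`) — and OPEN on `(18/25, 1]` (route budget: slope `1`, `+1`).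

References: Forbes2024LowDepth (CCC 2024, Thm. 1, Cor. 2); BhargavDuttaSaxena2024 (Thm. 1.4, Rem. 1.5);
LimayeSrinivasanTavenas2025 (Cor. 4); Burgisser2024Completeness (Thm. 2.20); Burgisser2000 (Ch. 2);
Valiant1979.
-/

noncomputable section

open MvPolynomial

-- the summit and the problem share the name `ValiantsHypothesis` (D-0017 single-conjunct layout)
set_option linter.dupNamespace false

namespace Summit.ValiantsHypothesis.ValiantsHypothesis.Theorems.SuccinctLiftSmlAnyFieldDetBDS

open Literature.Computability.AlgebraicComplexity ArithCircuit
open SuccinctLiftSmlAnyField SuccinctLiftSmlAnyFieldBDS SuccinctLiftSmlAnyFieldDet SuccinctLiftTwoNonUnit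
open DepthWindow DefinabilityGapK1DepthLadder

universe u

/-! ### Engine-agnostic tower bookkeeping -/

/-- **From eventual `IMM` hardness at slope `p/q` over `K` to the determinant dial at slope `p/q`
over `K`** (engine-agnostic form of `SuccinctLiftSmlAnyFieldDet.not_detEasyOver_anyField`):
`IMM_{m,⌊√log₂ m⌋}` is a p-projection of `(det_n)` over any commutative ring
(`isPProjection_detPoly_of_isVPwsFamily`), padding `det_m ≤_proj det_{m'}`, tower point
`m = 2^2^2^Y`, depth slack `p + 1`. [cite: Burgisser2024Completeness, Thm. 2.20]
[cite: LimayeSrinivasanTavenas2025, Cor. 4] -/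
theorem not_detEasyOver_of_immHard (K : Type) [Field K] {p q : ℕ}
    (hI : ∀ c : ℕ, ∃ m₁ : ℕ, ∀ m : ℕ, m₁ ≤ m →
      ∀ D : ArithCircuit K (Fin (Nat.sqrt (Nat.log 2 m)) × Fin m × Fin m),
        D.Computes (immPoly m (Nat.sqrt (Nat.log 2 m)) K) →
        D.productDepth ≤ p * Nat.log 2 (Nat.log 2 (Nat.log 2 m)) / q + c → m ^ c + c < D.edgeSize)
    (K₀ : ℕ) :
    ¬ DetEasyOver K (fun n => p * Nat.log 2 (Nat.log 2 (Nat.log 2 n)) / q + K₀) := by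
  classical
  rintro ⟨c, hC⟩
  obtain ⟨t, ⟨a, ha⟩, hproj⟩ :=
    isPProjection_detPoly_of_isVPwsFamily (isVPwsFamily_immPoly_sqrtLog K)
  -- the padded index `t' m = max (t m) m`
  obtain ⟨t', ht'⟩ : ∃ t' : ℕ → ℕ, ∀ m, t' m = max (t m) m := ⟨_, fun _ => rfl⟩
  have ht'le : ∀ m, t' m ≤ m ^ (a + 1) + (a + 1) := fun m => by
    rw [ht']
    refine max_le ((ha m).trans ?_) ?_
    · rcases Nat.eq_zero_or_pos m with rfl | hm
      · rcases Nat.eq_zero_or_pos a with rfl | hapos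
        · simp
        · rw [zero_pow hapos.ne', zero_pow (by omega)]; omega
      · exact Nat.add_le_add (Nat.pow_le_pow_right hm (Nat.le_succ a)) (Nat.le_succ a)
    · calc m = m ^ 1 := (pow_one m).symm
        _ ≤ m ^ (a + 1) := by
            rcases Nat.eq_zero_or_pos m with rfl | hm
            · simp
            · exact Nat.pow_le_pow_right hm (by omega)
        _ ≤ m ^ (a + 1) + (a + 1) := Nat.le_add_right _ _
  obtain ⟨b, hb⟩ : IsPBounded fun m => t' m ^ c + c :=
    IsPBounded.comp_holds (s := fun N => N ^ c + c) ⟨c, fun N => le_rfl⟩ ⟨a + 1, ht'le⟩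
  -- transport: a circuit for `det_{t' m}` yields one for `IMM_{m, ⌊√log₂ m⌋}`
  have key : ∀ (m : ℕ) (Γ : ArithCircuit K (Fin (t' m) × Fin (t' m))),
      Γ.Computes (detPoly (Fin (t' m)) K) →
      ∃ D : ArithCircuit K (Fin (Nat.sqrt (Nat.log 2 m)) × Fin m × Fin m),
        D.Computes (immPoly m (Nat.sqrt (Nat.log 2 m)) K) ∧ D.productDepth ≤ Γ.productDepth ∧
          D.edgeSize ≤ Γ.edgeSize := by
    intro m Γ hΓ
    have hproj' : IsProjection (immPoly m (Nat.sqrt (Nat.log 2 m)) K) (detPoly (Fin (t' m)) K) :=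
      IsProjection.trans_holds (hproj m)
        (isProjection_detPoly_of_le K (by rw [ht']; exact le_max_left _ _))
    obtain ⟨D, hDc, hDd, hDe, -⟩ := exists_circuit_of_isProjectionK hproj' Γ hΓ
    exact ⟨D, hDc, hDd, hDe⟩
  -- constants: exponent / depth slack, hardness threshold `m₁`, tower point `m = 2^2^2^Y`
  obtain ⟨m₁, hm₁⟩ := hI (b + p + K₀ + 2)
  obtain ⟨Y, hYa, hYm⟩ : ∃ Y : ℕ, a + 2 ≤ 2 ^ Y ∧ m₁ ≤ Y := by
    refine ⟨a + m₁ + 2, ?_, by omega⟩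
    have : a + m₁ + 2 < 2 ^ (a + m₁ + 2) := Nat.lt_two_pow_self
    omega
  obtain ⟨m, hm⟩ : ∃ m : ℕ, m = 2 ^ (2 ^ (2 ^ Y)) := ⟨_, rfl⟩
  have hYle : Y ≤ m := by
    have h1 : Y < 2 ^ Y := Nat.lt_two_pow_self
    have h2 : 2 ^ Y < 2 ^ (2 ^ Y) := Nat.pow_lt_pow_right (by norm_num) h1
    have h3 : 2 ^ (2 ^ Y) < 2 ^ (2 ^ (2 ^ Y)) := Nat.pow_lt_pow_right (by norm_num) h2
    omega
  have hm1 : 1 ≤ m := hm ▸ Nat.one_le_two_pow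
  obtain ⟨Γ, hΓ, hdepth, hle⟩ := hC (t' m)
  obtain ⟨D, hDc, hDd, hDe⟩ := key m Γ hΓ
  have hL3m : Nat.log 2 (Nat.log 2 (Nat.log 2 m)) = Y := hm ▸ log3_tower Y
  have hL3n : Nat.log 2 (Nat.log 2 (Nat.log 2 (t' m))) ≤ Y + 1 :=
    log3_le_of_le_tower_pow Y (a + 1) (t' m) hYa (hm ▸ ht'le m)
  have hdepthD : D.productDepth ≤
      p * Nat.log 2 (Nat.log 2 (Nat.log 2 m)) / q + (b + p + K₀ + 2) := by
    rw [hL3m]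
    have hslack := mul_succ_div_le p Y q
    calc D.productDepth ≤ Γ.productDepth := hDd
      _ ≤ p * Nat.log 2 (Nat.log 2 (Nat.log 2 (t' m))) / q + K₀ := hdepth
      _ ≤ p * (Y + 1) / q + K₀ :=
          Nat.add_le_add_right (Nat.div_le_div_right (Nat.mul_le_mul_left _ hL3n)) _
      _ ≤ p * Y / q + (b + p + K₀ + 2) := by omega
  have hlt := hm₁ m (by omega) D hDc hdepthD
  have hsize : D.edgeSize ≤ m ^ b + b := hDe.trans (hle.trans (hb m))
  have hmono : m ^ b + b ≤ m ^ (b + p + K₀ + 2) + (b + p + K₀ + 2) :=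
    Nat.add_le_add (Nat.pow_le_pow_right hm1 (by omega)) (by omega)
  omega

/-- **From eventual `IMM` hardness at slope `p/q` over `K` to the PERMANENT dial at slope `p/q` over
`K`** (engine-agnostic form of `SuccinctLiftSmlAnyFieldDet.not_perEasyOver_anyField`): characteristic
`2` through `per = det`, characteristic `≠ 2` through the `VNP`-completeness of the permanent over `K`
(`isVNPComplete_perPoly_holds`). [cite: Valiant1979] [cite: Burgisser2000, Ch. 2] -/
theorem not_perEasyOver_of_immHard (K : Type) [Field K] {p q : ℕ}
    (hI : ∀ c : ℕ, ∃ m₁ : ℕ, ∀ m : ℕ, m₁ ≤ m →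
      ∀ D : ArithCircuit K (Fin (Nat.sqrt (Nat.log 2 m)) × Fin m × Fin m),
        D.Computes (immPoly m (Nat.sqrt (Nat.log 2 m)) K) →
        D.productDepth ≤ p * Nat.log 2 (Nat.log 2 (Nat.log 2 m)) / q + c → m ^ c + c < D.edgeSize)
    (K₀ : ℕ) :
    ¬ PerEasyOver K (fun n => p * Nat.log 2 (Nat.log 2 (Nat.log 2 n)) / q + K₀) := by
  classical
  by_cases hchar : ringChar K = 2
  · haveI : CharP K 2 := ringChar.of_eq hchar
    exact fun h => not_detEasyOver_of_immHard K hI K₀ ((perEasyOver_iff_detEasyOver_of_charTwo K _).mp h)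
  rintro ⟨c, hC⟩
  let dd : ℕ → ℕ := fun m => Nat.sqrt (Nat.log 2 m)
  have hdd_le : ∀ m, dd m ≤ m := fun m => (Nat.sqrt_le_self _).trans (Nat.log_le_self 2 m)
  let v : ℕ → ℕ := fun m => Fintype.card (Fin (dd m) × Fin m × Fin m)
  let e : ∀ m, (Fin (dd m) × Fin m × Fin m) ≃ Fin (v m) := fun m => Fintype.equivFin _
  let G : ∀ m, MvPolynomial (Fin (dd m) × Fin m × Fin m) K := fun m => immPoly m (dd m) K
  let G' : ∀ m, MvPolynomial (Fin (v m)) K := fun m => renameEquiv K (e m) (G m)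
  have hv : ∀ m, Fintype.card (Fin (dd m) × Fin m × Fin m) ≤ m ^ 3 + 3 := card_immVars_le
  have hG : IsVPFamily G := by
    refine ⟨⟨⟨3, fun m => hv m⟩, ⟨1, fun m => ?_⟩⟩, ⟨6, fun m => ?_⟩⟩
    · show (immPoly m (dd m) K).totalDegree ≤ m ^ 1 + 1
      refine ((immPoly_isHomogeneous_holds (k := K) m (dd m)).totalDegree_le).trans ?_
      rw [pow_one]; exact (hdd_le m).trans (Nat.le_succ m)
    · show complexity (immPoly m (dd m) K) ≤ m ^ 6 + 6
      calc complexity (immPoly m (dd m) K) ≤ m + 2 * m ^ 3 * dd m := complexity_immPoly_le K m (dd m)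
        _ ≤ m ^ 1 + 2 * (m ^ 1) ^ 3 * m := by
            rw [pow_one]; exact Nat.add_le_add_left (Nat.mul_le_mul_left _ (hdd_le m)) _
        _ ≤ m ^ (3 * 1 + 3) + (3 * 1 + 3) := imm_cost_le 1 m
        _ = m ^ 6 + 6 := by norm_num
  have hG' : IsVPFamily G' := (isVPFamily_renameEquiv_iff e G).2 hG
  have hG'N : IsVNPFamily G' := IsVPFamily.isVNPFamily_holds' hG'
  obtain ⟨t, ht, hproj⟩ := (isVNPComplete_perPoly_holds K hchar).2 v G' hG'N
  obtain ⟨a, ha⟩ := ht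
  obtain ⟨t', ht'⟩ : ∃ t' : ℕ → ℕ, ∀ m, t' m = max (t m) m := ⟨_, fun _ => rfl⟩
  have ht'le : ∀ m, t' m ≤ m ^ (a + 1) + (a + 1) := fun m => by
    rw [ht']
    refine max_le ((ha m).trans ?_) ?_
    · rcases Nat.eq_zero_or_pos m with rfl | hm
      · rcases Nat.eq_zero_or_pos a with rfl | hapos
        · simp
        · rw [zero_pow hapos.ne', zero_pow (by omega)]; omega
      · exact Nat.add_le_add (Nat.pow_le_pow_right hm (Nat.le_succ a)) (Nat.le_succ a)
    · calc m = m ^ 1 := (pow_one m).symm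
        _ ≤ m ^ (a + 1) := by
            rcases Nat.eq_zero_or_pos m with rfl | hm
            · simp
            · exact Nat.pow_le_pow_right hm (by omega)
        _ ≤ m ^ (a + 1) + (a + 1) := Nat.le_add_right _ _
  obtain ⟨b, hb⟩ : IsPBounded fun m => t' m ^ c + c :=
    IsPBounded.comp_holds (s := fun N => N ^ c + c) ⟨c, fun N => le_rfl⟩ ⟨a + 1, ht'le⟩
  -- transport: a circuit for `per_{t' m}` yields one for `IMM_{m, dd m}`, same depth, no more wires
  have key : ∀ (m : ℕ) (Γ : ArithCircuit K (Fin (t' m) × Fin (t' m))), Γ.Computes (perPoly (Fin (t' m)) K) →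
      ∃ D : ArithCircuit K (Fin (dd m) × Fin m × Fin m),
        D.Computes (G m) ∧ D.productDepth ≤ Γ.productDepth ∧ D.edgeSize ≤ Γ.edgeSize := by
    intro m Γ hΓ
    have hproj' : IsProjection (G' m) (perPoly (Fin (t' m)) K) :=
      IsProjection.trans_holds (hproj m) (isProjection_perPoly_of_le K (by rw [ht']; exact le_max_left _ _))
    obtain ⟨D', hD'c, hD'd, hD'e, -⟩ := exists_circuit_of_isProjectionK hproj' Γ hΓ
    have hGm : MvPolynomial.rename (e m).symm (G' m) = G m := by
      show MvPolynomial.rename (e m).symm (renameEquiv K (e m) (G m)) = G m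
      rw [renameEquiv_apply, rename_rename, (e m).symm_comp_self, rename_id_apply]
    refine ⟨D'.rename (e m).symm, ?_, ?_, ?_⟩
    · rw [ArithCircuit.Computes, ← hGm]; exact hD'c.rename (e m).symm
    · exact (DepthThreeChasm.productDepth_rename _ _).le.trans hD'd
    · exact (DepthThreeChasm.edgeSize_rename _ _).le.trans hD'e
  obtain ⟨m₁, hm₁⟩ := hI (b + p + K₀ + 2)
  obtain ⟨Y, hYa, hYm⟩ : ∃ Y : ℕ, a + 2 ≤ 2 ^ Y ∧ m₁ ≤ Y := by
    refine ⟨a + m₁ + 2, ?_, by omega⟩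
    have : a + m₁ + 2 < 2 ^ (a + m₁ + 2) := Nat.lt_two_pow_self
    omega
  obtain ⟨m, hm⟩ : ∃ m : ℕ, m = 2 ^ (2 ^ (2 ^ Y)) := ⟨_, rfl⟩
  have hYle : Y ≤ m := by
    have h1 : Y < 2 ^ Y := Nat.lt_two_pow_self
    have h2 : 2 ^ Y < 2 ^ (2 ^ Y) := Nat.pow_lt_pow_right (by norm_num) h1
    have h3 : 2 ^ (2 ^ Y) < 2 ^ (2 ^ (2 ^ Y)) := Nat.pow_lt_pow_right (by norm_num) h2
    omega
  have hm1 : 1 ≤ m := hm ▸ Nat.one_le_two_pow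
  obtain ⟨Γ, hΓ, hdepth, hle⟩ := hC (t' m)
  obtain ⟨D, hDc, hDd, hDe⟩ := key m Γ hΓ
  have hL3m : Nat.log 2 (Nat.log 2 (Nat.log 2 m)) = Y := hm ▸ log3_tower Y
  have hL3n : Nat.log 2 (Nat.log 2 (Nat.log 2 (t' m))) ≤ Y + 1 :=
    log3_le_of_le_tower_pow Y (a + 1) (t' m) hYa (hm ▸ ht'le m)
  have hdepthD : D.productDepth ≤
      p * Nat.log 2 (Nat.log 2 (Nat.log 2 m)) / q + (b + p + K₀ + 2) := by
    rw [hL3m]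
    have hslack := mul_succ_div_le p Y q
    calc D.productDepth ≤ Γ.productDepth := hDd
      _ ≤ p * Nat.log 2 (Nat.log 2 (Nat.log 2 (t' m))) / q + K₀ := hdepth
      _ ≤ p * (Y + 1) / q + K₀ :=
          Nat.add_le_add_right (Nat.div_le_div_right (Nat.mul_le_mul_left _ hL3n)) _
      _ ≤ p * Y / q + (b + p + K₀ + 2) := by omega
  have hlt := hm₁ m (by omega) D hDc hdepthD
  have hsize : D.edgeSize ≤ m ^ b + b := hDe.trans (hle.trans (hb m))
  have hmono : m ^ b + b ≤ m ^ (b + p + K₀ + 2) + (b + p + K₀ + 2) :=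
    Nat.add_le_add (Nat.pow_le_pow_right hm1 (by omega)) (by omega)
  omega

/-! ### Every field, every slope `≤ 18/25` -/

/-- **The DETERMINANT is hard at product depth `⌊σ·L₃ n⌋ + K₀` over EVERY field, every `σ ≤ 18/25`.**
[cite: Forbes2024LowDepth, Cor. 2] [cite: BhargavDuttaSaxena2024, Thm. 1.4, Rem. 1.5] -/
theorem not_detEasyOver_anyField_of_le_18_25 (K : Type) [Field K] {p q : ℕ} (hpq : 25 * p ≤ 18 * q)
    (K₀ : ℕ) : ¬ DetEasyOver K (fun n => p * Nat.log 2 (Nat.log 2 (Nat.log 2 n)) / q + K₀) :=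
  not_detEasyOver_of_immHard K (immHard_anyField_bds K hpq) K₀

/-- **The PERMANENT is hard at product depth `⌊σ·L₃ n⌋ + K₀` over EVERY field, every `σ ≤ 18/25`.**
[cite: Forbes2024LowDepth, Cor. 2] [cite: BhargavDuttaSaxena2024, Thm. 1.4, Rem. 1.5] [cite: Valiant1979] -/
theorem not_perEasyOver_anyField_of_le_18_25 (K : Type) [Field K] {p q : ℕ} (hpq : 25 * p ≤ 18 * q)
    (K₀ : ℕ) : ¬ PerEasyOver K (fun n => p * Nat.log 2 (Nat.log 2 (Nat.log 2 n)) / q + K₀) :=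
  not_perEasyOver_of_immHard K (immHard_anyField_bds K hpq) K₀

/-- **The VP-internal LEAF of W34 over `𝔽̄₂`, DECIDED at every slope `≤ 18/25`** (route budget: slope
`1`, `+1`). [cite: Forbes2024LowDepth, Cor. 2] [cite: BhargavDuttaSaxena2024, Thm. 1.4, Rem. 1.5] -/
theorem not_detEasyOver_algClosure_two_of_le_18_25 {p q : ℕ} (hpq : 25 * p ≤ 18 * q) (K₀ : ℕ) :
    ¬ DetEasyOver (AlgebraicClosure (ZMod 2))
      (fun n => p * Nat.log 2 (Nat.log 2 (Nat.log 2 n)) / q + K₀) :=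
  not_detEasyOver_anyField_of_le_18_25 _ hpq K₀

/-- **`D_int(2, ⌊σ L₃⌋ + K₀)` for every `σ ≤ 18/25`.** [cite: Forbes2024LowDepth, Cor. 2]
[cite: Burgisser2000, §4.1] -/
theorem nonUnitHardAt_two_of_le_18_25 {p q : ℕ} (hpq : 25 * p ≤ 18 * q) (K₀ : ℕ) :
    NonUnitHardAt 2 (fun n => p * Nat.log 2 (Nat.log 2 (Nat.log 2 n)) / q + K₀) :=
  nonUnitHardAt_two_of_not_detEasyOver_algClosure _ (not_detEasyOver_algClosure_two_of_le_18_25 hpq K₀)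

/-- **`D_int(r, ⌊σ L₃⌋ + K₀)` for EVERY prime `r` and every `σ ≤ 18/25`.** [cite: Forbes2024LowDepth, Cor. 2]
[cite: Burgisser2000, §4.1] -/
theorem nonUnitHardAt_of_le_18_25 (r : ℕ) [Fact r.Prime] {p q : ℕ} (hpq : 25 * p ≤ 18 * q) (K₀ : ℕ) :
    NonUnitHardAt r (fun n => p * Nat.log 2 (Nat.log 2 (Nat.log 2 n)) / q + K₀) :=
  nonUnitHardAt_of_not_perEasyOver_algClosure _
    (not_perEasyOver_anyField_of_le_18_25 (AlgebraicClosure (ZMod r)) hpq K₀)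

/-- The endpoint `σ = 18/25` itself, over every field (closed instance). [cite: Forbes2024LowDepth, Cor. 2]
[cite: BhargavDuttaSaxena2024, Thm. 1.4, Rem. 1.5] -/
theorem not_detEasyOver_anyField_18_25 (K : Type) [Field K] (K₀ : ℕ) :
    ¬ DetEasyOver K (fun n => 18 * Nat.log 2 (Nat.log 2 (Nat.log 2 n)) / 25 + K₀) :=
  not_detEasyOver_anyField_of_le_18_25 K (p := 18) (q := 25) le_rfl K₀

end Summit.ValiantsHypothesis.ValiantsHypothesis.Theorems.SuccinctLiftSmlAnyFieldDetBDS
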